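import Summits.QuantumFields.YangMills.Theorems.BalabanUVNodesN07H1OfRecordTraceSectors
import Literature.MathematicalPhysics.QuantumFieldTheory.Balaban1983to89.Node00.BgRemainderOfRecord
import HarnessLib

/-!
# NODE N07 — THE `𝒢`-LETTER `𝔊(U₀; Δ₁)` OF def-Y's SCHEME, READ IN THE TYPE OF (115), MAPS TRACELESS CURRENTS TO TRACELESS JETS at every guarded background, every `N ≥ 1`,
# for every Hessian slot `Δ₁` commuting with the fibrewise scalar part (`𝔊 = G₁ − G₁Q†K⁻¹QG₁ − G₁DRD*G₁` on the functions; every factor respects the trace sectors) — the TRACE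
# half of the `𝒢`-row of ✓`Node00.BgSchemeChartLie.sol_mem_of_rows` at slot (a); slot (c) = the same with `Δ₁ := π†(Δ + Δ⁽²⁾)π` once `π`, `Δ⁽²⁾`, `G′` are shown to commute
# ([15] (110)–(111) p. 294, (116)–(117) p. 295, (51) p. 286; [B9] (3.153) p. 426)

Cell `pub-ymgap`, width seat `pub-ymgap-dag-n07-w3` (g26), CLAIM-21.  `--kind proof --supports stmt-QuantumFields-27238 --as helper`; count-neutral.  The trace companion of ✓p822030
`…N07FrakGOfRecordReality` §1.  [15] = [Balaban1985Variational]; [B9] = [Balaban1985BackgroundPropagators].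

CONTENTS (`S := scalPartW N _`; «traceless function» `g` := `∀ i, tr (g i) = 0`; «traceless-valued» `x` := `∀ i, tr φ(x i) = 0`).
* §1 bridges: `traceless_funEquiv_symm`, `traceless_funEquiv`, `traceless_readFun`, `traceless_of_comm` (a letter commuting with `S` preserves traceless-valued fields).
* §2 ★★★`trace_equiv_frakGOfRecordAt_eq_zero` — for a traceless current `f`, every value of the jet `𝔊(U₀; Δ₁) f` is traceless (guard; `Δ₁` commuting with `S`; displayed `hpos`, `hQ`);
  `trace_equiv_frakGOfRecordAtBgFlat_eq_zero_two` (`N = 2`, slot (a): bare `Δ(U₀)`).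

HONEST LABELS.  Linear bookkeeping; no estimate; slot (c) (`π`, `Δ⁽²⁾`, `G′`), `H♭`'s (115) reading, `C^{𝔰𝔩}`, `W` trace letters still owed.  Count-neutral; N07 NOT discharged; P0 ⟨26900⟩
OPEN; R4 is the conditional finite-𝕋⁴ rung only.  Nothing here is a claim about the Yang–Mills mass gap (`Summit.QuantumFields`): finite torus, fixed `ε`; nothing continuum ∕ OS ∕ Clay.
-/

set_option autoImplicit false

noncomputable section

open scoped Matrix Matrix.Norms.L2Operator InnerProductSpace ComplexConjugate BigOperators

namespace Summit.QuantumFields.YangMills.Theorems.N07FrakGOfRecordTraceSectors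

open Literature.MathematicalPhysics.QuantumFieldTheory.Balaban1983to89
open Literature.MathematicalPhysics.QuantumFieldTheory.Balaban1983to89.T4Continuum (T4Family)
open T4Continuum BlockAveraging
open Node00
open B9SectCLatticeCarrier (Bond)
open B9Eq311L2Pairing (WL2)
open B11Eq103H1Complex (SiteL2K BondL2K covDerivL2K covDivL2K G1LatticeK KinvLatticeK funEquiv funEquiv_apply funEquiv_symm_apply readFun readFun_apply
  G1Fun QFun QadjFun DFun DstarFun frakGLatticeCLM)
open B11Eq115Space (NegSup NegSize levWeight JetSup)
open B11Eq111FrakG (nabla115 frakG frakG_apply frakGLin frakGLin_apply)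
open Summit.QuantumFields.YangMills.Theorems.N07TraceSectorDefs (scalPartW)
open Summit.QuantumFields.YangMills.Theorems.N07TraceSectorProjection (comp_scalPartW_eq_iff scalPartW_eq_zero_iff scalPartW_comp_covDerivL2K_ofRecord
  scalPartW_comp_covDivL2K_ofRecord scalPartW_comp_RrOfRecord scalPartW_comp_hessOpOfRecord_two)
open Summit.QuantumFields.YangMills.Theorems.N07H1OfRecordTraceSectors (scalPartW_comp_QOfRecord scalPartW_adjoint_QOfRecord scalPartW_G1LatticeK_ofRecord
  scalPartW_KinvLatticeK_ofRecord)

/-! ## §1  Bridges between traceless functions and traceless-valued fields -/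

section Bridges

variable (N : ℕ) {ι : Type*} (w : ι → ℝ) {ι' : Type*} (w' : ι' → ℝ)

/-- Reading a traceless function as a field gives a traceless-valued field. [cite: Balaban1985Averaging, (18)–(19) p.21 (bookkeeping)] -/
theorem traceless_funEquiv_symm {g : ι → Matrix (Fin N) (Fin N) ℂ} (hg : ∀ i, (g i).trace = 0) (i : ι) :
    (phiRec N (WL2.equiv ℂ w (WRec N) ((funEquiv (phiRec N) w).symm g) i)).trace = 0 := by
  rw [← funEquiv_apply (phiRec N) w, LinearEquiv.apply_symm_apply]
  exact hg i

/-- Reading a traceless-valued field as a function gives a traceless function. [cite: Balaban1985Averaging, (18)–(19) p.21 (bookkeeping)] -/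
theorem traceless_funEquiv {x : WL2 ℂ w (WRec N)} (hx : ∀ i, (phiRec N (WL2.equiv ℂ w (WRec N) x i)).trace = 0) (i : ι) :
    (funEquiv (phiRec N) w x i).trace = 0 := by
  rw [funEquiv_apply]; exact hx i

/-- **A LETTER COMMUTING WITH THE SCALAR PART MAPS TRACELESS-VALUED FIELDS TO TRACELESS-VALUED FIELDS** (`N ≥ 1`). [cite: Balaban1985Variational, (51) p.286] -/
theorem traceless_of_comm [NeZero N] {T : WL2 ℂ w (WRec N) →ₗ[ℂ] WL2 ℂ w' (WRec N)} (hT : ∀ x, T (scalPartW N w x) = scalPartW N w' (T x))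
    {x : WL2 ℂ w (WRec N)} (hx : ∀ i, (phiRec N (WL2.equiv ℂ w (WRec N) x i)).trace = 0) (j : ι') :
    (phiRec N (WL2.equiv ℂ w' (WRec N) (T x) j)).trace = 0 :=
  ((comp_scalPartW_eq_iff N w w' T).1 (LinearMap.ext fun x => (hT x).symm)).1 x hx j

/-- **A letter preserving traceless-valued fields, READ ON THE FUNCTIONS, preserves traceless functions.** [cite: Balaban1985Variational, (51) p.286] -/
theorem traceless_readFun {T : WL2 ℂ w (WRec N) →ₗ[ℂ] WL2 ℂ w' (WRec N)}
    (hT : ∀ x : WL2 ℂ w (WRec N), (∀ i, (phiRec N (WL2.equiv ℂ w (WRec N) x i)).trace = 0) → ∀ j, (phiRec N (WL2.equiv ℂ w' (WRec N) (T x) j)).trace = 0)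
    {g : ι → Matrix (Fin N) (Fin N) ℂ} (hg : ∀ i, (g i).trace = 0) (j : ι') : (readFun (phiRec N) w w' T g j).trace = 0 := by
  rw [readFun_apply]
  exact traceless_funEquiv N w' (hT _ (traceless_funEquiv_symm N w hg)) j

end Bridges

/-! ## §2  `𝔊(U₀; Δ₁)` maps traceless currents to traceless jets -/

section Record

variable (F : T4Family) (N : ℕ) [NeZero N] {K : ℕ} (k : ℕ) (U₀ : GaugeField (F.P K) 0 (SU N)) [Fact (0 < c0Rec F K k)] [Fact (∀ c, 0 < wBRec F K k c)]
  [Fact (0 < (F.L : ℝ))] [Fact (0 < (F.P K).eta k)] (Ω : ℕ → Set (Site (F.P K) 0))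
  {Δ₁ : BondL2K ℂ (F.P K).d (fun _ => (F.P K).sitesPerDir 0) (c0Rec F K k) (WRec N) →ₗ[ℂ]
    BondL2K ℂ (F.P K).d (fun _ => (F.P K).sitesPerDir 0) (c0Rec F K k) (WRec N)} {a : ℝ}
  (hpos : ∀ x, x ≠ 0 → 0 < RCLike.re ⟪x, laplaceAOfRecordAt F N k U₀ Δ₁ (QOfRecord F N k U₀) (QflatOfRecord F N k) a x⟫_ℂ)

set_option maxRecDepth 16384 in
/-- ★★★ **THE JET `𝔊(U₀; Δ₁) f` OF A TRACELESS CURRENT `f` IS TRACELESS AT EVERY BOND** — for every Hessian slot `Δ₁` commuting with the scalar part, under 35b's guard (`𝔊 = G₁𝔓*`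
read on the functions: `G₁`, `Q`, `Q†`, `K⁻¹`, `D`, `R`, `D*` all respect the trace sectors, ✓`…N07H1OfRecordTraceSectors`, ✓`…N07TraceSectorProjection`, ✓`…N07RecordLettersTraceSectors`).
[cite: Balaban1985Variational, (110)–(111) p.294, (116)–(117) p.295, (51) p.286; Balaban1985BackgroundPropagators, (3.153) p.426] -/
theorem trace_equiv_frakGOfRecordAt_eq_zero (h : SmallBelow (avOfRecord F N K) k U₀) (hΔ₁ : ∀ x, Δ₁ (scalPartW N _ x) = scalPartW N _ (Δ₁ x))
    (hQ : Function.Surjective (QOfRecord F N k U₀)) {f : NegSizeLit F N K k Ω 3}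
    (hf : ∀ b, (NegSup.equiv (levWeight (F.L : ℝ) ((F.P K).eta k) (bondLevLit F Ω k) 3) (Matrix (Fin N) (Fin N) ℂ) f b).trace = 0)
    (b : Bond (F.P K).d (fun _ => (F.P K).sitesPerDir 0)) :
    (JetSup.equiv _ _ (nabla115 ((F.P K).eta k) (unitsOfRecord F N U₀))
        (frakGOfRecordAt F N K k Ω U₀ Δ₁ (QOfRecord F N k U₀) (QflatOfRecord F N k) a hpos hQ f) b).trace = 0 := by
  -- the letters preserve traceless-valued fields
  have hG : ∀ x : BondL2K ℂ (F.P K).d (fun _ => (F.P K).sitesPerDir 0) (c0Rec F K k) (WRec N),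
      (∀ i, (phiRec N (WL2.equiv ℂ _ (WRec N) x i)).trace = 0) → ∀ j, (phiRec N (WL2.equiv ℂ _ (WRec N) (G1LatticeK hpos x) j)).trace = 0 :=
    fun x hx => traceless_of_comm N _ _ (scalPartW_G1LatticeK_ofRecord F N k U₀ hpos h hΔ₁) hx
  have hKi : ∀ y : WL2 ℂ (wBRec F K k) (WRec N),
      (∀ i, (phiRec N (WL2.equiv ℂ _ (WRec N) y i)).trace = 0) → ∀ j, (phiRec N (WL2.equiv ℂ _ (WRec N) (KinvLatticeK hpos hQ y) j)).trace = 0 :=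
    fun y hy => traceless_of_comm N _ _ (scalPartW_KinvLatticeK_ofRecord F N k U₀ hpos h hΔ₁ hQ) hy
  have hQt : ∀ x : BondL2K ℂ (F.P K).d (fun _ => (F.P K).sitesPerDir 0) (c0Rec F K k) (WRec N),
      (∀ i, (phiRec N (WL2.equiv ℂ _ (WRec N) x i)).trace = 0) → ∀ j, (phiRec N (WL2.equiv ℂ _ (WRec N) (QOfRecord F N k U₀ x) j)).trace = 0 :=
    fun x hx => traceless_of_comm N _ _ (fun x => (LinearMap.congr_fun (scalPartW_comp_QOfRecord F N k U₀ h) x).symm) hx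
  have hQa : ∀ y : WL2 ℂ (wBRec F K k) (WRec N),
      (∀ i, (phiRec N (WL2.equiv ℂ _ (WRec N) y i)).trace = 0) →
        ∀ j, (phiRec N (WL2.equiv ℂ _ (WRec N) (LinearMap.adjoint (QOfRecord F N k U₀) y) j)).trace = 0 :=
    fun y hy => traceless_of_comm N _ _ (scalPartW_adjoint_QOfRecord F N k U₀ h) hy
  have hD : ∀ s : SiteL2K ℂ (F.P K).d (fun _ => (F.P K).sitesPerDir 0) (c0Rec F K k) (WRec N),
      (∀ i, (phiRec N (WL2.equiv ℂ _ (WRec N) s i)).trace = 0) →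
        ∀ j, (phiRec N (WL2.equiv ℂ _ (WRec N) (covDerivL2K ℂ (c0Rec F K k) (cRec F K k) (RRec F N U₀) s) j)).trace = 0 :=
    fun s hs => traceless_of_comm N _ _ (fun x => (LinearMap.congr_fun (scalPartW_comp_covDerivL2K_ofRecord F N K k U₀) x).symm) hs
  have hR : ∀ s : SiteL2K ℂ (F.P K).d (fun _ => (F.P K).sitesPerDir 0) (c0Rec F K k) (WRec N),
      (∀ i, (phiRec N (WL2.equiv ℂ _ (WRec N) s i)).trace = 0) →
        ∀ j, (phiRec N (WL2.equiv ℂ _ (WRec N) (RrOfRecord F N k U₀ (QflatOfRecord F N k) s) j)).trace = 0 :=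
    fun s hs => traceless_of_comm N _ _ (fun x => (LinearMap.congr_fun (scalPartW_comp_RrOfRecord F N K k U₀) x).symm) hs
  have hDs : ∀ x : BondL2K ℂ (F.P K).d (fun _ => (F.P K).sitesPerDir 0) (c0Rec F K k) (WRec N),
      (∀ i, (phiRec N (WL2.equiv ℂ _ (WRec N) x i)).trace = 0) →
        ∀ j, (phiRec N (WL2.equiv ℂ _ (WRec N) (covDivL2K ℂ (c0Rec F K k) (cRec F K k) (SRec F N U₀) x) j)).trace = 0 :=
    fun x hx => traceless_of_comm N _ _ (fun x => (LinearMap.congr_fun (scalPartW_comp_covDivL2K_ofRecord F N K k U₀) x).symm) hx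
  -- the current read as a traceless function
  set g : Bond (F.P K).d (fun _ => (F.P K).sitesPerDir 0) → Matrix (Fin N) (Fin N) ℂ :=
    NegSup.equiv (levWeight (F.L : ℝ) ((F.P K).eta k) (bondLevLit F Ω k) 3) (Matrix (Fin N) (Fin N) ℂ) f with hgdef
  have hg : ∀ i, (g i).trace = 0 := hf
  -- `G₁ g` traceless; the two correction terms traceless
  have t1 : ∀ j, (G1Fun (phiRec N) (G1LatticeK hpos) g j).trace = 0 := traceless_readFun N _ _ hG hg
  have t2 : ∀ j, (G1Fun (phiRec N) (G1LatticeK hpos) (QadjFun (phiRec N) (QOfRecord F N k U₀) (KinvLatticeK hpos hQ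
      (QFun (phiRec N) (QOfRecord F N k U₀) (G1Fun (phiRec N) (G1LatticeK hpos) g)))) j).trace = 0 := by
    refine traceless_readFun N _ _ hG (fun i => ?_)
    simp only [QadjFun, QFun, LinearMap.comp_apply, LinearEquiv.coe_coe]
    exact traceless_funEquiv N _ (hQa _ (hKi _ (hQt _ (traceless_funEquiv_symm N _ t1)))) i
  have t3 : ∀ j, (G1Fun (phiRec N) (G1LatticeK hpos) (DFun (phiRec N) (covDerivL2K ℂ (c0Rec F K k) (cRec F K k) (RRec F N U₀))
      (RrOfRecord F N k U₀ (QflatOfRecord F N k) (DstarFun (phiRec N) (covDivL2K ℂ (c0Rec F K k) (cRec F K k) (SRec F N U₀))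
        (G1Fun (phiRec N) (G1LatticeK hpos) g)))) j).trace = 0 := by
    refine traceless_readFun N _ _ hG (fun i => ?_)
    simp only [DFun, DstarFun, LinearMap.comp_apply, LinearEquiv.coe_coe]
    exact traceless_funEquiv N _ (hD _ (hR _ (hDs _ (traceless_funEquiv_symm N _ t1)))) i
  unfold frakGOfRecordAt frakGLatticeCLM
  rw [frakG_apply, ← hgdef, frakGLin_apply, Pi.sub_apply, Pi.sub_apply, Matrix.trace_sub, Matrix.trace_sub, t1 b, t2 b, t3 b, sub_zero, sub_zero]

end Record

section SU2

variable (F : T4Family) {K : ℕ} (k : ℕ) (U₀ : GaugeField (F.P K) 0 (SU 2)) [Fact (0 < c0Rec F K k)] [Fact (∀ c, 0 < wBRec F K k c)]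
  [Fact (0 < (F.L : ℝ))] [Fact (0 < (F.P K).eta k)] (Ω : ℕ → Set (Site (F.P K) 0))

set_option maxRecDepth 16384 in
/-- **SLOT (a), `N = 2`: the jet `𝔊(U₀) f` at the bare Hessian (`frakGOfRecordAtBgFlat`) of a traceless current is traceless at every bond** (✓`scalPartW_comp_hessOpOfRecord_two`).
[cite: Balaban1985Variational, (116)–(117) p.295, (51) p.286] -/
theorem trace_equiv_frakGOfRecordAtBgFlat_eq_zero_two (h : SmallBelow (avOfRecord F 2 K) k U₀) {a : ℝ}
    (hposb : ∀ x, x ≠ 0 → 0 < RCLike.re ⟪x, laplaceAOfRecord F 2 k U₀ (QOfRecord F 2 k U₀) (QflatOfRecord F 2 k) a x⟫_ℂ)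
    (hQ : Function.Surjective (QOfRecord F 2 k U₀)) {f : NegSizeLit F 2 K k Ω 3}
    (hf : ∀ b, (NegSup.equiv (levWeight (F.L : ℝ) ((F.P K).eta k) (bondLevLit F Ω k) 3) (Matrix (Fin 2) (Fin 2) ℂ) f b).trace = 0)
    (b : Bond (F.P K).d (fun _ => (F.P K).sitesPerDir 0)) :
    (JetSup.equiv _ _ (nabla115 ((F.P K).eta k) (unitsOfRecord F 2 U₀)) (frakGOfRecordAtBgFlat F 2 K k Ω U₀ a hposb hQ f) b).trace = 0 :=
  trace_equiv_frakGOfRecordAt_eq_zero F 2 k U₀ Ω hposb h (fun x => (LinearMap.congr_fun (scalPartW_comp_hessOpOfRecord_two F K k U₀) x).symm) hQ hf b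

end SU2

end Summit.QuantumFields.YangMills.Theorems.N07FrakGOfRecordTraceSectors

end
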